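import Summits.NavierStokesRegularity.FunctionalMining.MiddleEigenvalueMomentDoorReal
import Summits.NavierStokesRegularity.FunctionalMining.GradPressureMomentRateRpow
import Summits.NavierStokesRegularity.FunctionalMining.VorticityL4Pointwise
import Mathlib.Analysis.InnerProductSpace.NormPow
import HarnessLib

/-!
# The K1-Q2 door below `q = 2`: the exact Euler derivative of `Z_q` for every real `q > 1`

Search for candidate a priori estimates; no regularity claim. Cell `pub-nsfunc`, prove seat (gen 14).
K0 family `E.q`, column `C3b` (`MiddleEigenvalueMomentRateBound q C`: `dZ_q/dt ≤ C‖λ₂⁺(S)‖_∞ Z_q`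
along classical Navier–Stokes/Euler on `T³`). The tree's door `middleEigenvalueMomentRateBound_iff_staticReal`
(`MiddleEigenvalueMomentDoorReal`) and the spiral-jet kill-all (`NoGo/SpiralJetKillAll`) cover every real
`q ≥ 2`; the row `E.q=3/2|T_C|C3b` was out of reach because the scalar weight `s ↦ s^{q/2}` of
`Z_q = ∫(|ω|²)^{q/2}` is not `C¹` at `s = 0` for `q < 2`, so the tree's `Z_q` balance
(`hasDerivWithinAt_integral_torusVorticitySqAt_rpow_euler`, Gibbon 2010 App. A) starts at `q = 2`.

This file removes the restriction for the BACKWARD direction of the door (dynamic ⇒ static), which is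
all a refutation needs:

* `LowMomentDoor.hasDerivWithinAt_torusVorticityMoment_euler` — along a classical solution of unforced
  EULER on `T^d × [a, b]`, for every real `q > 1`, `s ↦ Z_q(u s)` has the one-sided derivative
  `q ∫ (|ω|²)^{q/2−1} σ` within `[a, b]`. The weight is moved from the scalar `|ω|²` to the VECTOR
  `W = (Wᵢⱼ) ∈ ℝ^{d×d}` (`‖W‖² = 2|ω|²`): `W ↦ ‖W‖^q` is `C¹` on `ℝ^{d×d}` for `q > 1` (Mathlib
  `contDiff_norm_rpow`, derivative `q‖W‖^{q−2}⟪W, ·⟫`, `= 0` at `W = 0`), the time derivative is taken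
  with `C1Weight.hasDerivWithinAt_integral_comp_fderiv_of_contDiff` (`C1WeightIntegralVec`),
  `⟪W, ∂ₜW⟫ = ∂ₜ|ω|² = 2σ − (u·∇)|ω|²` (`timeDerivWithin_torusVorticitySqAt` at `ν = 0`, `f = 0`), and
  the transport term is `∫ (u·∇)‖W‖^q = ∫ div(‖W‖^q u) = 0` (`C¹` divergence theorem on the torus).
* `MiddleEigenvalueMomentRateBound.staticReal_of_one_lt` — dynamic ⇒ static for every real `q > 1`;
  `not_middleEigenvalueMomentRateBound_of_staticReal_violation_of_one_lt`,
  `middleEigenvalueMomentRateFailsReal_of_nonpos_middle_of_one_lt` — the certificate formats.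

Identities along smooth solutions and a reduction; nothing here is a regularity criterion. [ours]
-/

noncomputable section

open Set MeasureTheory Finset Filter Topology
open scoped InnerProductSpace RealInnerProductSpace ContDiff

namespace Summit.NavierStokesRegularity.FunctionalMining

open Literature.Analysis Literature.Analysis.FunctionSpaces Literature.Analysis.FunctionSpaces.Torus
  Literature.Analysis.FluidPDE

variable {d : Type*} [Fintype d] [DecidableEq d]

namespace LowMomentDoor

/-! ## 1. Coordinate calculus for Euclidean-valued maps on the torus -/

/-- Coordinates commute with partial derivatives for a `C¹` map into `EuclideanSpace ℝ ι`:
`∂ₖ(f_p)(x) = (∂ₖf(x))_p`. [folklore] -/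
theorem partialDeriv_euclidean_apply {ι : Type*} [Fintype ι]
    {f : UnitAddTorus d → EuclideanSpace ℝ ι} (hf : Torus.IsContDiff 1 f) (k : d)
    (x : UnitAddTorus d) (p : ι) :
    Torus.partialDeriv k (fun y => f y p) x = Torus.partialDeriv k f x p := by
  unfold Torus.partialDeriv
  set v : EuclideanSpace ℝ d := EuclideanSpace.single k 1 with hv
  have h1 : HasDerivAt (fun s : ℝ => f (x + Torus.proj (s • v))) (Torus.lineDeriv f x v) 0 := by
    simpa using Torus.hasDerivAt_comp_add_proj_smul hf x v 0
  have h2 := (EuclideanSpace.proj p : EuclideanSpace ℝ ι →L[ℝ] ℝ).hasFDerivAt.comp_hasDerivAt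
    (0 : ℝ) h1
  have h3 : HasDerivAt (fun s : ℝ => f (x + Torus.proj (s • v)) p) (Torus.lineDeriv f x v p) 0 :=
    h2
  unfold Torus.lineDeriv at h3 ⊢
  exact h3.deriv

/-- Chain rule on the torus for a vector-valued inner map: `∂ₖ(Φ ∘ θ)(x) = DΦ(θ(x))[∂ₖθ(x)]` for
`θ` of class `C¹` and `Φ` differentiable at `θ(x)`. [folklore] -/
theorem partialDeriv_comp_fderiv {G : Type*} [NormedAddCommGroup G] [NormedSpace ℝ G]
    {Φ : G → ℝ} {θ : UnitAddTorus d → G} (hθ : Torus.IsContDiff 1 θ) (x : UnitAddTorus d)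
    (hΦ : DifferentiableAt ℝ Φ (θ x)) (k : d) :
    Torus.partialDeriv k (fun y => Φ (θ y)) x = fderiv ℝ Φ (θ x) (Torus.partialDeriv k θ x) := by
  unfold Torus.partialDeriv
  set v : EuclideanSpace ℝ d := EuclideanSpace.single k 1 with hv
  have h1 : HasDerivAt (fun s : ℝ => θ (x + Torus.proj (s • v))) (Torus.lineDeriv θ x v) 0 := by
    simpa using Torus.hasDerivAt_comp_add_proj_smul hθ x v 0
  have hx0 : θ (x + Torus.proj ((0 : ℝ) • v)) = θ x := by simp
  have hΦ' : HasFDerivAt Φ (fderiv ℝ Φ (θ x)) (θ (x + Torus.proj ((0 : ℝ) • v))) := by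
    rw [hx0]; exact hΦ.hasFDerivAt
  have h2 := hΦ'.comp_hasDerivAt (0 : ℝ) h1
  have h3 : HasDerivAt (fun s : ℝ => Φ (θ (x + Torus.proj (s • v))))
      (fderiv ℝ Φ (θ x) (Torus.lineDeriv θ x v)) 0 :=
    h2
  unfold Torus.lineDeriv at h3 ⊢
  exact h3.deriv

/-- `⟪w, z⟫ = ∑_p w_p z_p` on `EuclideanSpace ℝ ι`. [folklore] -/
theorem inner_eq_sum {ι : Type*} [Fintype ι] (w z : EuclideanSpace ℝ ι) :
    ⟪w, z⟫_ℝ = ∑ p, w p * z p := by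
  rw [PiLp.inner_apply]
  refine Finset.sum_congr rfl fun p _ => ?_
  simp [mul_comm]

/-- `‖w‖^q = (‖w‖²)^{q/2}` and `‖w‖^{q−2} = (‖w‖²)^{q/2−1}`. [folklore] -/
theorem norm_rpow_eq_sq_rpow {E : Type*} [NormedAddCommGroup E] (w : E) (q : ℝ) :
    ‖w‖ ^ q = (‖w‖ ^ 2) ^ (q / 2) ∧ ‖w‖ ^ (q - 2) = (‖w‖ ^ 2) ^ (q / 2 - 1) := by
  have h : ∀ r : ℝ, (‖w‖ ^ 2) ^ (r / 2) = ‖w‖ ^ r := fun r => by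
    rw [show (‖w‖ ^ 2 : ℝ) = ‖w‖ ^ (2 : ℝ) by norm_cast, ← Real.rpow_mul (norm_nonneg _)]
    congr 1; ring
  refine ⟨(h q).symm, ?_⟩
  rw [show q / 2 - 1 = (q - 2) / 2 by ring, h]

/-! ## 2. The vorticity tensor as a Euclidean vector and its joint smoothness -/

/-- `(s, y) ↦ Wᵢⱼ(u(s))(y)` is jointly smooth on `[a, b] × T^d`. [folklore] -/
theorem isSmoothSpaceTimeOn_W {a b : ℝ} {u : ℝ → UnitAddTorus d → EuclideanSpace ℝ d}
    (hu : Torus.IsSmoothSpaceTimeOn (Icc a b) u) (hab : a < b) (i j : d) :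
    Torus.IsSmoothSpaceTimeOn (Icc a b) (fun s y => torusVorticityTensor (u s) i j y) :=
  ((hu.partialDeriv (uniqueDiffOn_Icc hab) i).apply j).sub
    ((hu.partialDeriv (uniqueDiffOn_Icc hab) j).apply i)

/-- The packaged tensor `(s, y) ↦ (Wᵢⱼ(u(s))(y))_{(i,j)} ∈ ℝ^{d×d}` is jointly smooth. [folklore] -/
theorem isSmoothSpaceTimeOn_Wvec {a b : ℝ} {u : ℝ → UnitAddTorus d → EuclideanSpace ℝ d}
    (hu : Torus.IsSmoothSpaceTimeOn (Icc a b) u) (hab : a < b) :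
    Torus.IsSmoothSpaceTimeOn (Icc a b) (fun s y => (WithLp.toLp 2
      (fun p : d × d => torusVorticityTensor (u s) p.1 p.2 y) : EuclideanSpace ℝ (d × d))) := by
  unfold Torus.IsSmoothSpaceTimeOn
  rw [contDiffOn_euclidean]
  intro p
  exact isSmoothSpaceTimeOn_W hu hab p.1 p.2

/-- `‖(Wᵢⱼ)‖² = 2|ω|²`. [folklore] -/
theorem norm_Wvec_sq (v : UnitAddTorus d → EuclideanSpace ℝ d) (y : UnitAddTorus d) :
    ‖(WithLp.toLp 2 (fun p : d × d => torusVorticityTensor v p.1 p.2 y) : EuclideanSpace ℝ (d × d))‖ ^ 2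
      = 2 * torusVorticitySqAt v y := by
  rw [EuclideanSpace.norm_sq_eq, ← VorticityL4.sum_vorticityTensor_sq v y, Fintype.sum_prod_type]
  refine Finset.sum_congr rfl fun i _ => Finset.sum_congr rfl fun j _ => ?_
  rw [PiLp.toLp_apply, Real.norm_eq_abs, sq_abs]

/-! ## 3. The exact Euler derivative of `Z_q`, every real `q > 1` -/

/-- **Euler, unforced, every real `q > 1`: `d/dt Z_q = q ∫ (|ω|²)^{q/2−1} σ` exactly** along a
classical solution of the incompressible Euler equations (`ν = 0`, `f = 0`) on `T^d × [a, b]`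
(one-sided within `[a, b]`). For `q ≥ 2` this is the tree's
`hasDerivWithinAt_integral_torusVorticitySqAt_rpow_euler` (scalar `C¹` weight `s ↦ s^{q/2}`); for
`1 < q < 2` the scalar weight is not `C¹` at `0`, and the derivative is taken instead through the
VECTOR weight `W ↦ ‖W‖^q` on `ℝ^{d×d}`, which is `C¹` for `q > 1` (Mathlib `contDiff_norm_rpow`),
with the tool `C1Weight.hasDerivWithinAt_integral_comp_fderiv_of_contDiff`; the transport term is
`∫ (u·∇)‖W‖^q = ∫ div(‖W‖^q u) = 0` by the `C¹` divergence theorem. At a zero of `ω` the integrand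
`(|ω|²)^{q/2−1}σ` is `0` (Lean's `0 ^ r = 0` for `r ≠ 0`), consistently with `D(‖·‖^q)(0) = 0`.
[ours; folklore calculus] -/
theorem hasDerivWithinAt_torusVorticityMoment_euler {q : ℝ} (hq : 1 < q)
    {a b : ℝ} {u : ℝ → UnitAddTorus d → EuclideanSpace ℝ d} {p : ℝ → UnitAddTorus d → ℝ}
    (h : Torus.IsClassicalNSSolutionOn (Icc a b) 0 0 u p) (hab : a < b) {t : ℝ} (ht : t ∈ Icc a b) :
    HasDerivWithinAt (fun s => ∫ x, torusVorticitySqAt (u s) x ^ (q / 2))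
      (q * ∫ x, torusVorticitySqAt (u t) x ^ (q / 2 - 1) * torusStretchingDensity (u t) x)
      (Icc a b) t := by
  set S : Set ℝ := Icc a b with hSdef
  have hU : UniqueDiffOn ℝ S := uniqueDiffOn_Icc hab
  have hu : Torus.IsSmoothSpaceTimeOn S u := h.smooth_velocity
  have hut : Torus.IsSmooth (u t) := hu.isSmooth_slice ht
  have hu1 : Torus.IsContDiff 1 (u t) := hut.isContDiff (by simp)
  have hdiv : Torus.IsDivFree (u t) := h.divFree t ht
  -- the packaged vorticity tensor
  set θ : ℝ → UnitAddTorus d → EuclideanSpace ℝ (d × d) := fun s y =>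
    WithLp.toLp 2 (fun p : d × d => torusVorticityTensor (u s) p.1 p.2 y) with hθdef
  have hθ : Torus.IsSmoothSpaceTimeOn S θ := isSmoothSpaceTimeOn_Wvec hu hab
  have hθt : Torus.IsSmooth (θ t) := hθ.isSmooth_slice ht
  have hθt1 : Torus.IsContDiff 1 (θ t) := hθt.isContDiff (by simp)
  have hθsq : ∀ s y, ‖θ s y‖ ^ 2 = 2 * torusVorticitySqAt (u s) y := fun s y => norm_Wvec_sq (u s) y
  have hθapp : ∀ s y (p : d × d), θ s y p = torusVorticityTensor (u s) p.1 p.2 y := fun s y p => rfl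
  -- the weight
  set Φ : EuclideanSpace ℝ (d × d) → ℝ := fun w => ‖w‖ ^ q with hΦdef
  have hΦ : ContDiff ℝ 1 Φ := contDiff_norm_rpow hq
  have hΦd : ∀ w, DifferentiableAt ℝ Φ w := fun w => (differentiable_norm_rpow hq) w
  have hΦ' : ∀ w z, fderiv ℝ Φ w z = q * ‖w‖ ^ (q - 2) * ⟪w, z⟫_ℝ := fun w z =>
    fderiv_norm_rpow_apply' hq w z
  -- Step 1: differentiate under the integral sign
  have hD := C1Weight.hasDerivWithinAt_integral_comp_fderiv_of_contDiff hab hθ hΦ ht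
  -- Step 2: identify `∫ Φ(θ s) = 2^{q/2} Z_q(u s)`
  have hval : ∀ s, (∫ y, Φ (θ s y)) = (2 : ℝ) ^ (q / 2) * ∫ y, torusVorticitySqAt (u s) y ^ (q / 2) := by
    intro s
    rw [← integral_const_mul]
    refine integral_congr_ae (ae_of_all _ fun y => ?_)
    show ‖θ s y‖ ^ q = _
    rw [(norm_rpow_eq_sq_rpow (θ s y) q).1, hθsq,
      Real.mul_rpow (by norm_num) (torusVorticitySqAt_nonneg _ _)]
  -- Step 3: the time derivative of `θ` paired with `θ` is the time derivative of `|ω|²`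
  set θ' : UnitAddTorus d → EuclideanSpace ℝ (d × d) := Torus.timeDerivWithin S θ t with hθ'def
  set T : UnitAddTorus d → ℝ := fun y => ∑ k, u t y k * ∑ i, ∑ j, torusVorticityTensor (u t) i j y *
    Torus.partialDeriv k (torusVorticityTensor (u t) i j) y with hTdef
  have hinner : ∀ y, ⟪θ t y, θ' y⟫_ℝ = 2 * torusStretchingDensity (u t) y - T y := by
    intro y
    have hsl : HasDerivWithinAt (fun τ => θ τ y) (θ' y) S t := hθ.hasDerivWithinAt_slice ht y
    have hin := hsl.inner ℝ hsl
    have e1 : ∀ τ, ⟪θ τ y, θ τ y⟫_ℝ = 2 * torusVorticitySqAt (u τ) y := fun τ => by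
      rw [real_inner_self_eq_norm_sq, hθsq]
    have hQ2 : HasDerivWithinAt (fun τ => 2 * torusVorticitySqAt (u τ) y)
        (⟪θ t y, θ' y⟫_ℝ + ⟪θ' y, θ t y⟫_ℝ) S t :=
      hin.congr_of_mem (fun τ _ => (e1 τ).symm) ht
    have hQ : HasDerivWithinAt (fun τ => torusVorticitySqAt (u τ) y) (⟪θ t y, θ' y⟫_ℝ) S t := by
      have := hQ2.const_mul (2⁻¹ : ℝ)
      refine (this.congr_of_mem (fun τ _ => by ring) ht).congr_deriv ?_
      rw [real_inner_comm (θ' y)]; ring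
    have hQ' : Torus.timeDerivWithin S (fun s z => torusVorticitySqAt (u s) z) t y = ⟪θ t y, θ' y⟫_ℝ :=
      hQ.derivWithin (hU t ht)
    rw [← hQ', h.timeDerivWithin_torusVorticitySqAt hab ht y]
    have h0' : ∀ i, Torus.partialDeriv i (0 : UnitAddTorus d → EuclideanSpace ℝ d) y = 0 := by
      intro i
      simp [Torus.partialDeriv, Torus.lineDeriv]
    simp [h0', hTdef]
  -- Step 4: the transport term integrates to zero (`C¹` divergence theorem for `‖W‖^q u`)
  set g : UnitAddTorus d → ℝ := fun y => Φ (θ t y) with hgdef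
  have hg1 : Torus.IsContDiff 1 g := by
    unfold Torus.IsContDiff at hθt1 ⊢
    exact hΦ.comp hθt1
  have hBk : ∀ k y, fderiv ℝ Φ (θ t y) (Torus.partialDeriv k (θ t) y) = q * ‖θ t y‖ ^ (q - 2) *
      ∑ i, ∑ j, torusVorticityTensor (u t) i j y *
        Torus.partialDeriv k (torusVorticityTensor (u t) i j) y := by
    intro k y
    rw [hΦ', inner_eq_sum, Fintype.sum_prod_type]
    congr 1
    refine Finset.sum_congr rfl fun i _ => Finset.sum_congr rfl fun j _ => ?_
    rw [← partialDeriv_euclidean_apply hθt1 k y (i, j)]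
  have hgk : ∀ k y, Torus.partialDeriv k g y = fderiv ℝ Φ (θ t y) (Torus.partialDeriv k (θ t) y) :=
    fun k y => partialDeriv_comp_fderiv hθt1 y (hΦd _) k
  set B : UnitAddTorus d → ℝ := fun y =>
    ∑ k, u t y k * fderiv ℝ Φ (θ t y) (Torus.partialDeriv k (θ t) y) with hBdef
  have hBT : ∀ y, B y = q * ‖θ t y‖ ^ (q - 2) * T y := by
    intro y
    simp only [hBdef, hTdef, hBk, Finset.mul_sum]
    refine Finset.sum_congr rfl fun k _ => ?_
    ring
  have htrans : ∫ y, B y = 0 := by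
    have hgu : Torus.IsContDiff 1 (fun z => g z • u t z) := by
      unfold Torus.IsContDiff at hg1 hu1 ⊢
      exact hg1.smul hu1
    have hpt : ∀ y, B y = Torus.divergence (fun z => g z • u t z) y := by
      intro y
      rw [Torus.divergence_smul hg1 hu1 y, hdiv y, mul_zero, zero_add, hBdef]
      simp only [hgk]
    simp_rw [hpt]
    exact Torus.integral_divergence_eq_zero_of_isContDiff hgu
  -- Step 5: continuity bookkeeping and assembly
  have hθ'c : Continuous θ' := (hθ.isSmooth_timeDerivWithin hU ht).continuous
  have hDΦc : Continuous (fun y => fderiv ℝ Φ (θ t y)) :=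
    (hΦ.continuous_fderiv one_ne_zero).comp hθt.continuous
  have hFc : Continuous (fun y => fderiv ℝ Φ (θ t y) (θ' y)) := hDΦc.clm_apply hθ'c
  have hBc : Continuous B := by
    refine continuous_finsetSum _ fun k _ => ?_
    exact ((hut.apply k).continuous).mul (hDΦc.clm_apply ((hθt.partialDeriv k).continuous))
  have htot : ∀ y, fderiv ℝ Φ (θ t y) (θ' y) =
      2 * q * (‖θ t y‖ ^ (q - 2) * torusStretchingDensity (u t) y) - B y := by
    intro y
    rw [hΦ', hinner, hBT]
    ring
  have hAi : Integrable (fun y => 2 * q * (‖θ t y‖ ^ (q - 2) * torusStretchingDensity (u t) y)) := by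
    have hc : Continuous (fun y => fderiv ℝ Φ (θ t y) (θ' y) + B y) := hFc.add hBc
    refine (hc.integrable_unitAddTorus).congr (ae_of_all _ fun y => ?_)
    simp only [htot]
    ring
  have hBi : Integrable B := hBc.integrable_unitAddTorus
  have hθpow : ∀ y, ‖θ t y‖ ^ (q - 2) = (2 : ℝ) ^ (q / 2 - 1) * torusVorticitySqAt (u t) y ^ (q / 2 - 1) := by
    intro y
    rw [(norm_rpow_eq_sq_rpow (θ t y) q).2, hθsq,
      Real.mul_rpow (by norm_num) (torusVorticitySqAt_nonneg _ _)]
  have h2pow : (2 : ℝ) * (2 : ℝ) ^ (q / 2 - 1) = (2 : ℝ) ^ (q / 2) := by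
    rw [Real.rpow_sub_one (by norm_num) (q / 2)]
    ring
  have hderiv_val : (∫ y, fderiv ℝ Φ (θ t y) (θ' y)) = (2 : ℝ) ^ (q / 2) *
      (q * ∫ y, torusVorticitySqAt (u t) y ^ (q / 2 - 1) * torusStretchingDensity (u t) y) := by
    simp_rw [htot]
    rw [integral_sub hAi hBi, htrans, sub_zero]
    simp_rw [hθpow]
    rw [← h2pow, ← integral_const_mul, ← integral_const_mul]
    refine integral_congr_ae (ae_of_all _ fun y => ?_)
    ring
  -- the derivative of `2^{q/2} Z_q`; divide by `2^{q/2}`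
  have h2pos : (0 : ℝ) < (2 : ℝ) ^ (q / 2) := Real.rpow_pos_of_pos (by norm_num) _
  have hD' : HasDerivWithinAt (fun s => (2 : ℝ) ^ (q / 2) * ∫ y, torusVorticitySqAt (u s) y ^ (q / 2))
      ((2 : ℝ) ^ (q / 2) *
        (q * ∫ y, torusVorticitySqAt (u t) y ^ (q / 2 - 1) * torusStretchingDensity (u t) y)) S t := by
    rw [← hderiv_val]
    exact hD.congr_of_mem (fun s _ => (hval s).symm) ht
  have hD'' := hD'.const_mul (((2 : ℝ) ^ (q / 2))⁻¹)
  refine (hD''.congr_of_mem (fun s _ => ?_) ht).congr_deriv ?_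
  · rw [← mul_assoc, inv_mul_cancel₀ h2pos.ne', one_mul]
  · rw [← mul_assoc, inv_mul_cancel₀ h2pos.ne', one_mul]

end LowMomentDoor

/-! ## 4. The K1-Q2 door (backward direction) for every real `q > 1` -/

/-- **Real-`q` door, backward: dynamic ⇒ static, for every real `q > 1`** (the tree's
`MiddleEigenvalueMomentRateBound.staticReal` needs `q ≥ 2`): run the local classical EULER solution
from the field (`Torus.exists_classicalNS_smooth` at `ν = 0`); at `t = 0` the exact derivative of
`Z_q` is `q∫(|ω|²)^{q/2−1}σ(v)` (`LowMomentDoor.hasDerivWithinAt_torusVorticityMoment_euler`, vector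
`C¹` weight), and the law bounds it by `CΛZ_q(v)`. Search for candidate a priori estimates; no
regularity claim. [ours] -/
theorem MiddleEigenvalueMomentRateBound.staticReal_of_one_lt {q : ℝ} (hq : 1 < q) {C : ℝ}
    (h : MiddleEigenvalueMomentRateBound (d := d) q C) :
    MiddleEigenvalueStretchingStaticReal (d := d) q C := by
  intro hd v hv hdiv Λ hΛ0 hΛ
  obtain ⟨T, hT, u, p, hsol, hu0, -⟩ := Torus.exists_classicalNS_smooth (d := d) hd.le le_rfl hv hdiv
  have h0 : (0 : ℝ) ∈ Icc 0 T := left_mem_Icc.2 hT.le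
  have hder := LowMomentDoor.hasDerivWithinAt_torusVorticityMoment_euler hq hsol hT h0
  have hder2 : HasDerivWithinAt (fun s => torusVorticityMoment q (u s))
      (q * ∫ x, torusVorticitySqAt (u 0) x ^ (q / 2 - 1) * torusStretchingDensity (u 0) x)
      (Icc 0 T) 0 := hder
  have hΛ' : ∀ x, ∀ hx : (Matrix.of fun i j =>
      (Torus.partialDeriv j (u 0) x i + Torus.partialDeriv i (u 0) x j) / 2).IsHermitian,
      hx.eigenvalues₀ (Fin.cast hd.symm 1) ≤ Λ := by
    rw [hu0]
    exact hΛ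
  have hle := h hd le_rfl hT hsol 0 h0 Λ hΛ0 hΛ' _ hder2
  rw [hu0] at hle
  exact hle

/-- **NO-GO CRITERION for K1-Q2 at every real exponent `q > 1`.** One smooth divergence-free field
`v` on `T³`, one admissible `Λ ≥ 0` and the strict violation `C·Λ·Z_q(v) < q∫(|ω|²)^{q/2−1}σ` refute
`MiddleEigenvalueMomentRateBound q C` — now also for the K0 row `E.q=3/2|T_C|C3b`. Search for
candidate a priori estimates; no regularity claim. [ours] -/
theorem not_middleEigenvalueMomentRateBound_of_staticReal_violation_of_one_lt {q : ℝ} (hq : 1 < q)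
    {C : ℝ} (hd : Fintype.card d = 3) {v : UnitAddTorus d → EuclideanSpace ℝ d} (hv : Torus.IsSmooth v)
    (hdiv : Torus.IsDivFree v) {Λ : ℝ} (hΛ0 : 0 ≤ Λ)
    (hΛ : ∀ x, ∀ hx : (Matrix.of fun i j =>
        (Torus.partialDeriv j v x i + Torus.partialDeriv i v x j) / 2).IsHermitian,
        hx.eigenvalues₀ (Fin.cast hd.symm 1) ≤ Λ)
    (hviol : C * Λ * torusVorticityMoment q v <
      q * ∫ x, torusVorticitySqAt v x ^ (q / 2 - 1) * torusStretchingDensity v x) :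
    ¬ MiddleEigenvalueMomentRateBound (d := d) q C := fun h =>
  absurd (h.staticReal_of_one_lt hq hd v hv hdiv Λ hΛ0 hΛ) (not_le.mpr hviol)

/-- **Refutation of EVERY constant at a real exponent `q > 1`**: a smooth divergence-free field on
`T³` with middle strain eigenvalue `≤ 0` everywhere and `q∫(|ω|²)^{q/2−1}σ > 0` kills
`MiddleEigenvalueMomentRateBound q C` for all `C`. Search for candidate a priori estimates; no
regularity claim. [ours] -/
theorem middleEigenvalueMomentRateFailsReal_of_nonpos_middle_of_one_lt {q : ℝ} (hq : 1 < q)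
    (hd : Fintype.card d = 3) {v : UnitAddTorus d → EuclideanSpace ℝ d} (hv : Torus.IsSmooth v)
    (hdiv : Torus.IsDivFree v)
    (hΛ : ∀ x, ∀ hx : (Matrix.of fun i j =>
        (Torus.partialDeriv j v x i + Torus.partialDeriv i v x j) / 2).IsHermitian,
        hx.eigenvalues₀ (Fin.cast hd.symm 1) ≤ 0)
    (hpos : 0 < q * ∫ x, torusVorticitySqAt v x ^ (q / 2 - 1) * torusStretchingDensity v x) :
    ∀ C : ℝ, ¬ MiddleEigenvalueMomentRateBound (d := d) q C := fun C =>
  not_middleEigenvalueMomentRateBound_of_staticReal_violation_of_one_lt hq hd hv hdiv le_rfl hΛ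
    (by simpa using hpos)

end Summit.NavierStokesRegularity.FunctionalMining

end
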